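import Summits.MatrixMultiplication.MatrixMultiplication.Theorems.AbelianSTPPCensusTAKnap575Defs

/-!
# T_A/575 certificate: kernel evaluation, volumes `451 … 575` (segment 6)

Cell mm-stpp (rung F-M1), T_A/575 = «no abelian STPP host of order `≤ 575` beats `τ = 2.371`»; checker and checkpoint rows in
`AbelianSTPPCensusTAKnap575Defs.lean` (= the landed T_A/450/473 checker `TAKnap`/`TAKnap473` at universe `575`, `Bmax = 430`, gains
`gainOf2371y`, budget `cap` with the three-room energy clause).  `decide` with kernel reduction (standard axioms, default heartbeats; no
`native_decide`).  Each segment recomputes the next checkpoint row from the previous one and checks every order `474 … 575` against every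
volume of its range; consumed by `TAKnap575.seg_sound` / `TAKnap575.loopVR_sound` in `AbelianSTPPCensusLeafTA575Closed.lean`.
WHAT THIS IS NOT: arithmetic on shape lists only; no statement about STPP families or `ω`.
-/

set_option linter.dupNamespace false
set_option autoImplicit false

namespace Summit.MatrixMultiplication.MatrixMultiplication.Theorems.TAKnap575

/-- Segment 6: volumes `451 … 575` from `row450`, all order checks `474 … 575` passing (the final row is not recorded). [original] -/
theorem seg6 : (loopVR 474 102 125 451 row450).1 = true := by decide +kernel

end Summit.MatrixMultiplication.MatrixMultiplication.Theorems.TAKnap575
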